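import Summits.CriticalPhenomena.PercolationContinuityZ3.Theorems.PercNearOneGluingNoHeavyLowerTailIncStarRootPairEvents
import Summits.CriticalPhenomena.PercolationContinuityZ3.Theorems.PercNearOneGluingNoHeavyLowerTailIncStarRootPairConcave
import Summits.CriticalPhenomena.PercolationContinuityZ3.Theorems.PercNearOneGluingNoHeavyLowerTailIncStarRootEdgeInduction
import HarnessLib

/-!
# Root-pair concavity at a separating vertex (B′-forest), III: the three-point inequality

Support file for the Sahi programme (`--supports stmt-CriticalPhenomena-4575`, prover prim-sahi-p2 gen 19/20).  No definitions, no named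
facts, no sorries; standard axioms.  Memo `prim-sahi-p2/PROOF-E3.md` (29n)–(29p), §30.

**Theorem `rootPair_threePoint` (B′ at a separating vertex, block form, CONCAVITY).**  Root `s`, root pair `e = s(s, x)`, a side `L` (`s, x ∉ L`)
with no positive pair from `L` to `V₂ ∖ {x}` (`V₂ = {y | y ∉ L ∧ y ≠ s}`), targets `a ∈ insert x L`, `b, c ∈ V₂`.  If the two-target functional
`Ψ_R` of the far block and the branch-lemma slack `Br_a` of the near block are nonnegative (block events under `w[e↦0]`; on apex-forests these are
`IncStar.psi_nonneg` and `IncStar.branchLemma` for the restricted weights), then for `0 ≤ p₀ ≤ p ≤ p₁ ≤ 1`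
`(p₁ − p)·E₃(w[e↦p₀]) + (p − p₀)·E₃(w[e↦p₁]) ≤ (p₁ − p₀)·E₃(w[e↦p])` for `E₃ = E₃({s↔a},{s↔b},{s↔c})` — the cubic is concave on `[0,1]`
(the chord form `(1 − w e)E₃(w[e↦0]) + (w e)E₃(w[e↦1]) ≤ E₃(w)` is the case `(p₀,p,p₁) = (0, w e, 1)`, see `…IncStarRootPairForest`).
Proof: the dictionary of part II turns the seven moments under `w[e↦0]` / `w[e↦1]` into the block polynomials of
`IncStar.rootPairChord_poly` (near atoms `m_a, D_a, H_a, A_L`, far atoms `m_b, m_c, m_bc, D_b, D_c, D_bc, Ξ_b, Ξ_c, H_b, H_c, H_bc, A_R`), every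
moment under `w[e↦q]` is the `q`-mixture of the two (one-bond decomposition), and `IncStar.rootPairCubic_concave_real` concludes.
-/

noncomputable section

namespace Summit.CriticalPhenomena.PercolationContinuityZ3.Theorems

namespace IncStar

open MeasureTheory Set Literature.Probability.Percolation Literature.Probability.LatticeModels EdgeInduction
open scoped Classical

variable {n : ℕ}

/-- Almost-sure congruence (local copy of the plumbing lemma of `…IncStarBridgeEvents`). [folklore] -/
private theorem rp_congr {μ : Measure (BondConfig (Fin n))} [IsProbabilityMeasure μ] {G A A' : Set (BondConfig (Fin n))}
    (hG : μ.real G = 1) (h : ∀ ω ∈ G, (ω ∈ A ↔ ω ∈ A')) : μ.real A = μ.real A' := by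
  rw [real_eq_real_inter_of_real_eq_one MeasurableSet.of_discrete hG A,
    real_eq_real_inter_of_real_eq_one MeasurableSet.of_discrete hG A']
  congr 1
  ext ω
  simp only [Set.mem_inter_iff]
  constructor
  · rintro ⟨h1, h2⟩; exact ⟨(h ω h2).1 h1, h2⟩
  · rintro ⟨h1, h2⟩; exact ⟨(h ω h2).2 h1, h2⟩

set_option maxHeartbeats 400000 in
/-- **B′ at a separating vertex (block form): `E₃` is concave along the root pair `s(s,x)` (three-point form).** [this work] -/
theorem rootPair_threePoint (w : Sym2 (Fin n) → unitInterval) (L : Set (Fin n)) {s x a b c : Fin n}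
    (hxs : x ≠ s) (hsL : s ∉ L) (hxL : x ∉ L) (haL : a ∈ (insert x L : Set (Fin n)))
    (hbL : b ∉ L) (hbs : b ≠ s) (hcL : c ∉ L) (hcs : c ≠ s)
    (hcross : ∀ y z : Fin n, y ∈ L → z ∉ L → z ≠ s → z ≠ x → w s(y, z) = 0)
    (p₀ p p₁ : unitInterval) (h01 : p₀ ≤ p) (h12 : p ≤ p₁)
    (hPsi : 0 ≤ (prodBernoulli (Function.update w s(s, x) 0)).real
          (Set.univ \ {ω | ∃ u ∈ {u : Fin n | u ∉ L ∧ u ≠ s ∧ u ≠ x}, s(s, u) ∈ ω ∧ ω ∈ openConnIn {y | y ∉ L ∧ y ≠ s} u x})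
        * ((prodBernoulli (Function.update w s(s, x) 0)).real
            ((openConnIn {y | y ∉ L ∧ y ≠ s} x b \ {ω | ∃ u ∈ {u : Fin n | u ∉ L ∧ u ≠ s ∧ u ≠ x}, s(s, u) ∈ ω ∧ ω ∈ openConnIn {y | y ∉ L ∧ y ≠ s} u x})
              ∩ {ω | ∃ u ∈ {u : Fin n | u ∉ L ∧ u ≠ s ∧ u ≠ x}, s(s, u) ∈ ω ∧ ω ∈ openConnIn {y | y ∉ L ∧ y ≠ s} u c})
          + (prodBernoulli (Function.update w s(s, x) 0)).real
            ((openConnIn {y | y ∉ L ∧ y ≠ s} x c \ {ω | ∃ u ∈ {u : Fin n | u ∉ L ∧ u ≠ s ∧ u ≠ x}, s(s, u) ∈ ω ∧ ω ∈ openConnIn {y | y ∉ L ∧ y ≠ s} u x})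
              ∩ {ω | ∃ u ∈ {u : Fin n | u ∉ L ∧ u ≠ s ∧ u ≠ x}, s(s, u) ∈ ω ∧ ω ∈ openConnIn {y | y ∉ L ∧ y ≠ s} u b})
          + (prodBernoulli (Function.update w s(s, x) 0)).real
            ((openConnIn {y | y ∉ L ∧ y ≠ s} x b ∩ openConnIn {y | y ∉ L ∧ y ≠ s} x c)
              \ {ω | ∃ u ∈ {u : Fin n | u ∉ L ∧ u ≠ s ∧ u ≠ x}, s(s, u) ∈ ω ∧ ω ∈ openConnIn {y | y ∉ L ∧ y ≠ s} u x}))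
        - (prodBernoulli (Function.update w s(s, x) 0)).real
            (openConnIn {y | y ∉ L ∧ y ≠ s} x b \ {ω | ∃ u ∈ {u : Fin n | u ∉ L ∧ u ≠ s ∧ u ≠ x}, s(s, u) ∈ ω ∧ ω ∈ openConnIn {y | y ∉ L ∧ y ≠ s} u x})
          * (prodBernoulli (Function.update w s(s, x) 0)).real
            (openConnIn {y | y ∉ L ∧ y ≠ s} x c \ {ω | ∃ u ∈ {u : Fin n | u ∉ L ∧ u ≠ s ∧ u ≠ x}, s(s, u) ∈ ω ∧ ω ∈ openConnIn {y | y ∉ L ∧ y ≠ s} u x})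
        + (prodBernoulli (Function.update w s(s, x) 0)).real
            (openConnIn {y | y ∉ L ∧ y ≠ s} x b \ {ω | ∃ u ∈ {u : Fin n | u ∉ L ∧ u ≠ s ∧ u ≠ x}, s(s, u) ∈ ω ∧ ω ∈ openConnIn {y | y ∉ L ∧ y ≠ s} u x})
          * ((prodBernoulli (Function.update w s(s, x) 0)).real
              (openConnIn {y | y ∉ L ∧ y ≠ s} x c \ {ω | ∃ u ∈ {u : Fin n | u ∉ L ∧ u ≠ s ∧ u ≠ x}, s(s, u) ∈ ω ∧ ω ∈ openConnIn {y | y ∉ L ∧ y ≠ s} u x})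
            + (prodBernoulli (Function.update w s(s, x) 0)).real
              ({ω | ∃ u ∈ {u : Fin n | u ∉ L ∧ u ≠ s ∧ u ≠ x}, s(s, u) ∈ ω ∧ ω ∈ openConnIn {y | y ∉ L ∧ y ≠ s} u c}
                \ {ω | ∃ u ∈ {u : Fin n | u ∉ L ∧ u ≠ s ∧ u ≠ x}, s(s, u) ∈ ω ∧ ω ∈ openConnIn {y | y ∉ L ∧ y ≠ s} u x})
            - (prodBernoulli (Function.update w s(s, x) 0)).real
              (Set.univ \ {ω | ∃ u ∈ {u : Fin n | u ∉ L ∧ u ≠ s ∧ u ≠ x}, s(s, u) ∈ ω ∧ ω ∈ openConnIn {y | y ∉ L ∧ y ≠ s} u x})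
              * ((prodBernoulli (Function.update w s(s, x) 0)).real
                  {ω | ∃ u ∈ {u : Fin n | u ∉ L ∧ u ≠ s ∧ u ≠ x}, s(s, u) ∈ ω ∧ ω ∈ openConnIn {y | y ∉ L ∧ y ≠ s} u c}
                + (prodBernoulli (Function.update w s(s, x) 0)).real
                  (openConnIn {y | y ∉ L ∧ y ≠ s} x c \ {ω | ∃ u ∈ {u : Fin n | u ∉ L ∧ u ≠ s ∧ u ≠ x}, s(s, u) ∈ ω ∧ ω ∈ openConnIn {y | y ∉ L ∧ y ≠ s} u x})))
        + (prodBernoulli (Function.update w s(s, x) 0)).real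
            (openConnIn {y | y ∉ L ∧ y ≠ s} x c \ {ω | ∃ u ∈ {u : Fin n | u ∉ L ∧ u ≠ s ∧ u ≠ x}, s(s, u) ∈ ω ∧ ω ∈ openConnIn {y | y ∉ L ∧ y ≠ s} u x})
          * ((prodBernoulli (Function.update w s(s, x) 0)).real
              (openConnIn {y | y ∉ L ∧ y ≠ s} x b \ {ω | ∃ u ∈ {u : Fin n | u ∉ L ∧ u ≠ s ∧ u ≠ x}, s(s, u) ∈ ω ∧ ω ∈ openConnIn {y | y ∉ L ∧ y ≠ s} u x})
            + (prodBernoulli (Function.update w s(s, x) 0)).real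
              ({ω | ∃ u ∈ {u : Fin n | u ∉ L ∧ u ≠ s ∧ u ≠ x}, s(s, u) ∈ ω ∧ ω ∈ openConnIn {y | y ∉ L ∧ y ≠ s} u b}
                \ {ω | ∃ u ∈ {u : Fin n | u ∉ L ∧ u ≠ s ∧ u ≠ x}, s(s, u) ∈ ω ∧ ω ∈ openConnIn {y | y ∉ L ∧ y ≠ s} u x})
            - (prodBernoulli (Function.update w s(s, x) 0)).real
              (Set.univ \ {ω | ∃ u ∈ {u : Fin n | u ∉ L ∧ u ≠ s ∧ u ≠ x}, s(s, u) ∈ ω ∧ ω ∈ openConnIn {y | y ∉ L ∧ y ≠ s} u x})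
              * ((prodBernoulli (Function.update w s(s, x) 0)).real
                  {ω | ∃ u ∈ {u : Fin n | u ∉ L ∧ u ≠ s ∧ u ≠ x}, s(s, u) ∈ ω ∧ ω ∈ openConnIn {y | y ∉ L ∧ y ≠ s} u b}
                + (prodBernoulli (Function.update w s(s, x) 0)).real
                  (openConnIn {y | y ∉ L ∧ y ≠ s} x b \ {ω | ∃ u ∈ {u : Fin n | u ∉ L ∧ u ≠ s ∧ u ≠ x}, s(s, u) ∈ ω ∧ ω ∈ openConnIn {y | y ∉ L ∧ y ≠ s} u x}))))
    (hBr : (prodBernoulli (Function.update w s(s, x) 0)).real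
          (Set.univ \ {ω | ∃ u ∈ L, s(s, u) ∈ ω ∧ ω ∈ openConnIn (insert x L) u x})
        * ((prodBernoulli (Function.update w s(s, x) 0)).real {ω | ∃ u ∈ L, s(s, u) ∈ ω ∧ ω ∈ openConnIn (insert x L) u a}
          + (prodBernoulli (Function.update w s(s, x) 0)).real
            (openConnIn (insert x L) x a \ {ω | ∃ u ∈ L, s(s, u) ∈ ω ∧ ω ∈ openConnIn (insert x L) u x}))
      ≤ (prodBernoulli (Function.update w s(s, x) 0)).real
            (openConnIn (insert x L) x a \ {ω | ∃ u ∈ L, s(s, u) ∈ ω ∧ ω ∈ openConnIn (insert x L) u x})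
        + 2 * (prodBernoulli (Function.update w s(s, x) 0)).real
            ({ω | ∃ u ∈ L, s(s, u) ∈ ω ∧ ω ∈ openConnIn (insert x L) u a} \ {ω | ∃ u ∈ L, s(s, u) ∈ ω ∧ ω ∈ openConnIn (insert x L) u x})) :
    ((p₁ : ℝ) - (p : ℝ)) * sahiE3 (prodBernoulli (Function.update w s(s, x) p₀)) (openConn s a) (openConn s b) (openConn s c)
      + ((p : ℝ) - (p₀ : ℝ)) * sahiE3 (prodBernoulli (Function.update w s(s, x) p₁)) (openConn s a) (openConn s b) (openConn s c)
    ≤ ((p₁ : ℝ) - (p₀ : ℝ)) * sahiE3 (prodBernoulli (Function.update w s(s, x) p)) (openConn s a) (openConn s b) (openConn s c) := by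
  -- names
  set e : Sym2 (Fin n) := s(s, x) with he_def
  set w0 := Function.update w e 0 with hw0
  set w1 := Function.update w e 1
  set V₁ : Set (Fin n) := insert x L
  set V₂ : Set (Fin n) := {y | y ∉ L ∧ y ≠ s}
  set R₀ : Set (Fin n) := {u : Fin n | u ∉ L ∧ u ≠ s ∧ u ≠ x}
  set AL : Set (BondConfig (Fin n)) := {ω | ∃ u ∈ L, s(s, u) ∈ ω ∧ ω ∈ openConnIn V₁ u a}
  set SL : Set (BondConfig (Fin n)) := {ω | ∃ u ∈ L, s(s, u) ∈ ω ∧ ω ∈ openConnIn V₁ u x}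
  set Fa : Set (BondConfig (Fin n)) := openConnIn V₁ x a
  set BRb : Set (BondConfig (Fin n)) := {ω | ∃ u ∈ R₀, s(s, u) ∈ ω ∧ ω ∈ openConnIn V₂ u b}
  set BRc : Set (BondConfig (Fin n)) := {ω | ∃ u ∈ R₀, s(s, u) ∈ ω ∧ ω ∈ openConnIn V₂ u c}
  set SR : Set (BondConfig (Fin n)) := {ω | ∃ u ∈ R₀, s(s, u) ∈ ω ∧ ω ∈ openConnIn V₂ u x}
  set Fb : Set (BondConfig (Fin n)) := openConnIn V₂ x b
  set Fc : Set (BondConfig (Fin n)) := openConnIn V₂ x c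
  have hm : ∀ X : Set (BondConfig (Fin n)), MeasurableSet X := fun _ => MeasurableSet.of_discrete
  -- (0) the sure set of `w0`
  set G : Set (BondConfig (Fin n)) := {ω | ∀ e', w0 e' = 0 → e' ∉ ω}
  have hG1 : (prodBernoulli w0).real G = 1 := real_sureClosed w0
  have hGe : ∀ ω ∈ G, e ∉ ω := fun ω hω => hω e (by rw [hw0, Function.update_self])
  have hGω : ∀ ω ∈ G, ∀ y z : Fin n, y ∈ L → z ∉ L → z ≠ s → z ≠ x → s(y, z) ∉ ω := by
    intro ω hω y z hy hz hzs hzx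
    refine hω _ ?_
    have hne : s(y, z) ≠ e := by
      intro h
      rw [he_def, Sym2.eq_iff] at h
      rcases h with ⟨h1, -⟩ | ⟨-, h2⟩
      · exact hsL (h1 ▸ hy)
      · exact hzs h2
    rw [hw0, Function.update_of_ne hne]
    exact hcross y z hy hz hzs hzx
  -- (1) structural facts (all configurations)
  have fL1 : ∀ {t : Fin n} (ω : BondConfig (Fin n)), ω ∈ {ω | ∃ u ∈ L, s(s, u) ∈ ω ∧ ω ∈ openConnIn V₁ u t} →
      ω ∈ openConnIn V₁ x t → ω ∈ SL := fun ω h hF => rootStar_port_of_rootStar_of_openConnIn L V₁ ω h hF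
  have fL2 : ∀ {t : Fin n} (ω : BondConfig (Fin n)), ω ∈ SL → ω ∈ openConnIn V₁ x t →
      ω ∈ {ω | ∃ u ∈ L, s(s, u) ∈ ω ∧ ω ∈ openConnIn V₁ u t} := fun ω h hF => rootStar_of_rootStar_port_of_openConnIn L V₁ ω h hF
  have fR1 : ∀ {t : Fin n} (ω : BondConfig (Fin n)), ω ∈ {ω | ∃ u ∈ R₀, s(s, u) ∈ ω ∧ ω ∈ openConnIn V₂ u t} →
      ω ∈ openConnIn V₂ x t → ω ∈ SR := fun ω h hF => rootStar_port_of_rootStar_of_openConnIn R₀ V₂ ω h hF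
  have fR2 : ∀ {t : Fin n} (ω : BondConfig (Fin n)), ω ∈ SR → ω ∈ openConnIn V₂ x t →
      ω ∈ {ω | ∃ u ∈ R₀, s(s, u) ∈ ω ∧ ω ∈ openConnIn V₂ u t} := fun ω h hF => rootStar_of_rootStar_port_of_openConnIn R₀ V₂ ω h hF
  -- (2) determining sets and independence
  set KL : Set (Sym2 (Fin n)) := {z : Sym2 (Fin n) | ¬ z.IsDiag ∧ ∀ v ∈ z, v ∈ V₁} ∪ {z | ∃ u ∈ L, z = s(s, u)}
  set KR : Set (Sym2 (Fin n)) := {z : Sym2 (Fin n) | ¬ z.IsDiag ∧ ∀ v ∈ z, v ∈ V₂} ∪ {z | ∃ u ∈ R₀, z = s(s, u)}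
  have indep : ∀ {A B : Set (BondConfig (Fin n))}, DeterminedBy A KL → DeterminedBy B KR →
      (prodBernoulli w0).real (A ∩ B) = (prodBernoulli w0).real A * (prodBernoulli w0).real B :=
    fun hA hB => rootPair_indep w0 L hxs hsL hA hB
  have hdiff : ∀ {A B : Set (BondConfig (Fin n))} {K' : Set (Sym2 (Fin n))},
      DeterminedBy A K' → DeterminedBy B K' → DeterminedBy (A \ B) K' := by
    intro A B K' hA hB
    rw [determinedBy_iff] at hA hB ⊢
    intro ω ω' h
    rw [Set.mem_sdiff, Set.mem_sdiff, hA ω ω' h, hB ω ω' h]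
  have hunion : ∀ {A B : Set (BondConfig (Fin n))} {K' : Set (Sym2 (Fin n))},
      DeterminedBy A K' → DeterminedBy B K' → DeterminedBy (A ∪ B) K' := by
    intro A B K' hA hB
    rw [determinedBy_iff] at hA hB ⊢
    intro ω ω' h
    rw [Set.mem_union, Set.mem_union, hA ω ω' h, hB ω ω' h]
  have dAL : DeterminedBy AL KL := determinedBy_rootStar L V₁ s a
  have dSL : DeterminedBy SL KL := determinedBy_rootStar L V₁ s x
  have dFa : DeterminedBy Fa KL := (IncStarCutVertex.determinedBy_openConnIn_offDiag V₁ x a).mono Set.subset_union_left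
  have dBRb : DeterminedBy BRb KR := determinedBy_rootStar R₀ V₂ s b
  have dBRc : DeterminedBy BRc KR := determinedBy_rootStar R₀ V₂ s c
  have dSR : DeterminedBy SR KR := determinedBy_rootStar R₀ V₂ s x
  have dFb : DeterminedBy Fb KR := (IncStarCutVertex.determinedBy_openConnIn_offDiag V₂ x b).mono Set.subset_union_left
  have dFc : DeterminedBy Fc KR := (IncStarCutVertex.determinedBy_openConnIn_offDiag V₂ x c).mono Set.subset_union_left
  have dSLc : DeterminedBy (Set.univ \ SL) KL := hdiff (determinedBy_univ _) dSL
  have dSRc : DeterminedBy (Set.univ \ SR) KR := hdiff (determinedBy_univ _) dSR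
  -- (3) dictionary on the sure set
  have cA : ∀ ω ∈ G, (ω ∈ openConn s a ↔ ω ∈ AL ∨ (ω ∈ SR ∧ ω ∈ Fa)) := fun ω hω =>
    rootPair_conn_left L hxs hsL hxL (hGω ω hω) (hGe ω hω) haL
  have cB : ∀ ω ∈ G, (ω ∈ openConn s b ↔ ω ∈ BRb ∨ (ω ∈ SL ∧ ω ∈ Fb)) := fun ω hω =>
    rootPair_conn_right L hxs hsL hxL (hGω ω hω) (hGe ω hω) hbL hbs
  have cC : ∀ ω ∈ G, (ω ∈ openConn s c ↔ ω ∈ BRc ∨ (ω ∈ SL ∧ ω ∈ Fc)) := fun ω hω =>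
    rootPair_conn_right L hxs hsL hxL (hGω ω hω) (hGe ω hω) hcL hcs
  have lA : ∀ ω ∈ G, (insert e ω ∈ openConn s a ↔ ω ∈ AL ∨ ω ∈ Fa) := fun ω hω =>
    rootPair_lift_left L hxs hsL hxL (hGω ω hω) (hGe ω hω) haL
  have lB : ∀ ω ∈ G, (insert e ω ∈ openConn s b ↔ ω ∈ BRb ∨ ω ∈ Fb) := fun ω hω =>
    rootPair_lift_right L hxs hsL hxL (hGω ω hω) (hGe ω hω) hbL hbs
  have lC : ∀ ω ∈ G, (insert e ω ∈ openConn s c ↔ ω ∈ BRc ∨ ω ∈ Fc) := fun ω hω =>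
    rootPair_lift_right L hxs hsL hxL (hGω ω hω) (hGe ω hω) hcL hcs
  -- (4) one-bond decomposition and the lift
  have ob : ∀ (q : unitInterval) (A : Set (BondConfig (Fin n))), (prodBernoulli (Function.update w e q)).real A
      = (1 - (q : ℝ)) * (prodBernoulli w0).real A + (q : ℝ) * (prodBernoulli w1).real A := by
    intro q A
    have hA : DeterminedBy A (↑(Finset.univ : Finset (Sym2 (Fin n))) : Set (Sym2 (Fin n))) := by
      rw [determinedBy_iff]
      intro ω ω' h
      rw [Finset.coe_univ, Set.inter_univ, Set.inter_univ] at h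
      rw [h]
    have h := prodBernoulli_real_oneBond hA (Function.update w e q) (Finset.mem_univ e)
    rwa [Function.update_idem, Function.update_idem, Function.update_self] at h
  have lift : ∀ A : Set (BondConfig (Fin n)),
      (prodBernoulli w1).real A = (prodBernoulli w0).real ((fun ω : BondConfig (Fin n) => insert e ω) ⁻¹' A) :=
    fun A => tieLiftOne_real_one_eq w e A
  -- (5) splits of block quantities
  have hSLc : (prodBernoulli w0).real SL = 1 - (prodBernoulli w0).real (Set.univ \ SL) := by
    rw [← Set.compl_eq_univ_sdiff, probReal_compl_eq_one_sub (hm _)]; ring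
  have hSRc : (prodBernoulli w0).real SR = 1 - (prodBernoulli w0).real (Set.univ \ SR) := by
    rw [← Set.compl_eq_univ_sdiff, probReal_compl_eq_one_sub (hm _)]; ring
  have kA : (prodBernoulli w0).real (AL ∩ SL) = (prodBernoulli w0).real AL - (prodBernoulli w0).real (AL \ SL) := by
    have h := measureReal_inter_add_sdiff (μ := prodBernoulli w0) (s := AL) (hm SL); linarith
  have kB : (prodBernoulli w0).real (SR ∩ BRb) = (prodBernoulli w0).real BRb - (prodBernoulli w0).real (BRb \ SR) := by
    have h := measureReal_inter_add_sdiff (μ := prodBernoulli w0) (s := BRb) (hm SR); rw [Set.inter_comm]; linarith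
  have kC : (prodBernoulli w0).real (SR ∩ BRc) = (prodBernoulli w0).real BRc - (prodBernoulli w0).real (BRc \ SR) := by
    have h := measureReal_inter_add_sdiff (μ := prodBernoulli w0) (s := BRc) (hm SR); rw [Set.inter_comm]; linarith
  have kBC : (prodBernoulli w0).real (SR ∩ (BRb ∩ BRc)) = (prodBernoulli w0).real (BRb ∩ BRc) - (prodBernoulli w0).real ((BRb ∩ BRc) \ SR) := by
    have h := measureReal_inter_add_sdiff (μ := prodBernoulli w0) (s := BRb ∩ BRc) (hm SR); rw [Set.inter_comm]; linarith
  have zA : (prodBernoulli w0).real (AL ∪ Fa) = (prodBernoulli w0).real AL + (prodBernoulli w0).real (Fa \ SL) :=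
    rootStar_union_split (prodBernoulli w0) L V₁ s x a
  have zB : (prodBernoulli w0).real (BRb ∪ Fb) = (prodBernoulli w0).real BRb + (prodBernoulli w0).real (Fb \ SR) :=
    rootStar_union_split (prodBernoulli w0) R₀ V₂ s x b
  have zC : (prodBernoulli w0).real (BRc ∪ Fc) = (prodBernoulli w0).real BRc + (prodBernoulli w0).real (Fc \ SR) :=
    rootStar_union_split (prodBernoulli w0) R₀ V₂ s x c
  have zBC : (prodBernoulli w0).real ((BRb ∪ Fb) ∩ (BRc ∪ Fc))
      = (prodBernoulli w0).real (BRb ∩ BRc) + (prodBernoulli w0).real ((Fb \ SR) ∩ BRc)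
        + (prodBernoulli w0).real ((Fc \ SR) ∩ BRb) + (prodBernoulli w0).real ((Fb ∩ Fc) \ SR) :=
    rootStar_inter_union_split (prodBernoulli w0) R₀ V₂ s x b c
  -- (6) moments under `w0`
  have mA0 : (prodBernoulli w0).real (openConn s a) = (prodBernoulli w0).real AL + (prodBernoulli w0).real (Fa \ SL) * (prodBernoulli w0).real SR := by
    rw [← indep (hdiff dFa dSL) dSR, ← measureReal_union ?_ (hm _)]
    · refine rp_congr hG1 fun ω hω => ?_
      rw [cA ω hω, Set.mem_union, Set.mem_inter_iff, Set.mem_sdiff]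
      constructor
      · rintro (h | ⟨hS, hF⟩)
        · exact Or.inl h
        · by_cases hSL : ω ∈ SL
          · exact Or.inl (fL2 ω hSL hF)
          · exact Or.inr ⟨⟨hF, hSL⟩, hS⟩
      · rintro (h | ⟨⟨hF, -⟩, hS⟩)
        · exact Or.inl h
        · exact Or.inr ⟨hS, hF⟩
    · exact Set.disjoint_left.2 fun ω hA h2 => h2.1.2 (fL1 ω hA h2.1.1)
  have mR0 : ∀ {t : Fin n} (Bt Ft : Set (BondConfig (Fin n))), Bt = {ω | ∃ u ∈ R₀, s(s, u) ∈ ω ∧ ω ∈ openConnIn V₂ u t} →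
      Ft = openConnIn V₂ x t → DeterminedBy Bt KR → DeterminedBy Ft KR →
      (∀ ω ∈ G, (ω ∈ openConn s t ↔ ω ∈ Bt ∨ (ω ∈ SL ∧ ω ∈ Ft))) →
      (prodBernoulli w0).real (openConn s t) = (prodBernoulli w0).real Bt + (prodBernoulli w0).real SL * (prodBernoulli w0).real (Ft \ SR) := by
    rintro t Bt Ft rfl rfl dB dF cT
    rw [← indep dSL (hdiff dF dSR), ← measureReal_union ?_ (hm _)]
    · refine rp_congr hG1 fun ω hω => ?_
      rw [cT ω hω, Set.mem_union, Set.mem_inter_iff, Set.mem_sdiff]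
      constructor
      · rintro (h | ⟨hS, hF⟩)
        · exact Or.inl h
        · by_cases hSR : ω ∈ SR
          · exact Or.inl (fR2 ω hSR hF)
          · exact Or.inr ⟨hS, hF, hSR⟩
      · rintro (h | ⟨hS, hF, -⟩)
        · exact Or.inl h
        · exact Or.inr ⟨hS, hF⟩
    · exact Set.disjoint_left.2 fun ω hB h2 => h2.2.2 (fR1 ω hB h2.2.1)
  have mB0 := mR0 BRb Fb rfl rfl dBRb dFb cB
  have mC0 := mR0 BRc Fc rfl rfl dBRc dFc cC
  have mAR0 : ∀ {t : Fin n} (Bt Ft : Set (BondConfig (Fin n))), Bt = {ω | ∃ u ∈ R₀, s(s, u) ∈ ω ∧ ω ∈ openConnIn V₂ u t} →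
      Ft = openConnIn V₂ x t → DeterminedBy Bt KR → DeterminedBy Ft KR →
      (∀ ω ∈ G, (ω ∈ openConn s t ↔ ω ∈ Bt ∨ (ω ∈ SL ∧ ω ∈ Ft))) →
      (prodBernoulli w0).real (openConn s a ∩ openConn s t)
        = (prodBernoulli w0).real (AL \ SL) * (prodBernoulli w0).real Bt
          + (prodBernoulli w0).real (Fa \ SL) * (prodBernoulli w0).real (SR ∩ Bt)
          + (prodBernoulli w0).real (AL ∩ SL) * (prodBernoulli w0).real (Bt ∪ Ft) := by
    rintro t Bt Ft rfl rfl dB dF cT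
    rw [← indep (hdiff dAL dSL) dB, ← indep (hdiff dFa dSL) (dSR.inter dB), ← indep (dAL.inter dSL) (hunion dB dF),
      ← measureReal_union ?_ (hm _), ← measureReal_union ?_ (hm _)]
    · refine rp_congr hG1 fun ω hω => ?_
      rw [Set.mem_inter_iff, cA ω hω, cT ω hω]
      simp only [Set.mem_union, Set.mem_inter_iff, Set.mem_sdiff]
      constructor
      · rintro ⟨hA | ⟨hSR, hFa⟩, hB | ⟨hSL, hFb⟩⟩
        · by_cases hSL : ω ∈ SL
          · exact Or.inr ⟨⟨hA, hSL⟩, Or.inl hB⟩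
          · exact Or.inl (Or.inl ⟨⟨hA, hSL⟩, hB⟩)
        · exact Or.inr ⟨⟨hA, hSL⟩, Or.inr hFb⟩
        · by_cases hSL : ω ∈ SL
          · exact Or.inr ⟨⟨fL2 ω hSL hFa, hSL⟩, Or.inl hB⟩
          · exact Or.inl (Or.inr ⟨⟨hFa, hSL⟩, hSR, hB⟩)
        · exact Or.inr ⟨⟨fL2 ω hSL hFa, hSL⟩, Or.inr hFb⟩
      · rintro ((⟨⟨hA, -⟩, hB⟩ | ⟨⟨hFa, -⟩, hSR, hB⟩) | ⟨⟨hA, hSL⟩, hB | hFb⟩)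
        · exact ⟨Or.inl hA, Or.inl hB⟩
        · exact ⟨Or.inr ⟨hSR, hFa⟩, Or.inl hB⟩
        · exact ⟨Or.inl hA, Or.inl hB⟩
        · exact ⟨Or.inl hA, Or.inr ⟨hSL, hFb⟩⟩
    · exact Set.disjoint_left.2 fun ω h1 h2 => by
        rcases h1 with h1 | h1 <;> exact h1.1.2 h2.1.2
    · exact Set.disjoint_left.2 fun ω h1 h2 => h1.1.2 (fL1 ω h1.1.1 h2.1.1)
  have mAB0 := mAR0 BRb Fb rfl rfl dBRb dFb cB
  have mAC0 := mAR0 BRc Fc rfl rfl dBRc dFc cC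
  have mBC0 : (prodBernoulli w0).real (openConn s b ∩ openConn s c)
      = (prodBernoulli w0).real (Set.univ \ SL) * (prodBernoulli w0).real (BRb ∩ BRc)
        + (prodBernoulli w0).real SL * (prodBernoulli w0).real ((BRb ∪ Fb) ∩ (BRc ∪ Fc)) := by
    rw [← indep dSLc (dBRb.inter dBRc), ← indep dSL ((hunion dBRb dFb).inter (hunion dBRc dFc)), ← measureReal_union ?_ (hm _)]
    · refine rp_congr hG1 fun ω hω => ?_
      rw [Set.mem_inter_iff, cB ω hω, cC ω hω]
      simp only [Set.mem_union, Set.mem_inter_iff, Set.mem_sdiff, Set.mem_univ, true_and]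
      constructor
      · rintro ⟨hB | ⟨hSL, hFb⟩, hC | ⟨hSL', hFc⟩⟩
        · by_cases hSL : ω ∈ SL
          · exact Or.inr ⟨hSL, Or.inl hB, Or.inl hC⟩
          · exact Or.inl ⟨hSL, hB, hC⟩
        · exact Or.inr ⟨hSL', Or.inl hB, Or.inr hFc⟩
        · exact Or.inr ⟨hSL, Or.inr hFb, Or.inl hC⟩
        · exact Or.inr ⟨hSL, Or.inr hFb, Or.inr hFc⟩
      · rintro (⟨hSL, hB, hC⟩ | ⟨hSL, hB | hFb, hC | hFc⟩)
        · exact ⟨Or.inl hB, Or.inl hC⟩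
        · exact ⟨Or.inl hB, Or.inl hC⟩
        · exact ⟨Or.inl hB, Or.inr ⟨hSL, hFc⟩⟩
        · exact ⟨Or.inr ⟨hSL, hFb⟩, Or.inl hC⟩
        · exact ⟨Or.inr ⟨hSL, hFb⟩, Or.inr ⟨hSL, hFc⟩⟩
    · exact Set.disjoint_left.2 fun ω h1 h2 => h1.1.2 h2.1
  have mABC0 : (prodBernoulli w0).real (openConn s a ∩ openConn s b ∩ openConn s c)
      = (prodBernoulli w0).real (AL \ SL) * (prodBernoulli w0).real (BRb ∩ BRc)
        + (prodBernoulli w0).real (Fa \ SL) * (prodBernoulli w0).real (SR ∩ (BRb ∩ BRc))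
        + (prodBernoulli w0).real (AL ∩ SL) * (prodBernoulli w0).real ((BRb ∪ Fb) ∩ (BRc ∪ Fc)) := by
    rw [← indep (hdiff dAL dSL) (dBRb.inter dBRc), ← indep (hdiff dFa dSL) (dSR.inter (dBRb.inter dBRc)),
      ← indep (dAL.inter dSL) ((hunion dBRb dFb).inter (hunion dBRc dFc)),
      ← measureReal_union ?_ (hm _), ← measureReal_union ?_ (hm _)]
    · refine rp_congr hG1 fun ω hω => ?_
      rw [Set.mem_inter_iff, Set.mem_inter_iff, cA ω hω, cB ω hω, cC ω hω]
      simp only [Set.mem_union, Set.mem_inter_iff, Set.mem_sdiff]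
      constructor
      · rintro ⟨⟨hA, hB⟩, hC⟩
        by_cases hSL : ω ∈ SL
        · refine Or.inr ⟨⟨?_, hSL⟩, hB.imp id (fun h => h.2), hC.imp id (fun h => h.2)⟩
          rcases hA with hA | ⟨-, hFa⟩
          · exact hA
          · exact fL2 ω hSL hFa
        · have hB' : ω ∈ BRb := hB.resolve_right fun h => hSL h.1
          have hC' : ω ∈ BRc := hC.resolve_right fun h => hSL h.1
          rcases hA with hA | ⟨hSR, hFa⟩
          · exact Or.inl (Or.inl ⟨⟨hA, hSL⟩, hB', hC'⟩)
          · exact Or.inl (Or.inr ⟨⟨hFa, hSL⟩, hSR, hB', hC'⟩)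
      · rintro ((⟨⟨hA, -⟩, hB, hC⟩ | ⟨⟨hFa, -⟩, hSR, hB, hC⟩) | ⟨⟨hA, hSL⟩, hB, hC⟩)
        · exact ⟨⟨Or.inl hA, Or.inl hB⟩, Or.inl hC⟩
        · exact ⟨⟨Or.inr ⟨hSR, hFa⟩, Or.inl hB⟩, Or.inl hC⟩
        · exact ⟨⟨Or.inl hA, hB.imp id (fun h => ⟨hSL, h⟩)⟩, hC.imp id (fun h => ⟨hSL, h⟩)⟩
    · exact Set.disjoint_left.2 fun ω h1 h2 => by
        rcases h1 with h1 | h1 <;> exact h1.1.2 h2.1.2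
    · exact Set.disjoint_left.2 fun ω h1 h2 => h1.1.2 (fL1 ω h1.1.1 h2.1.1)
  -- (7) moments under `w1`
  have mA1 : (prodBernoulli w1).real (openConn s a) = (prodBernoulli w0).real (AL ∪ Fa) := by
    rw [lift]; exact rp_congr hG1 fun ω hω => by rw [Set.mem_preimage, lA ω hω, Set.mem_union]
  have mB1 : (prodBernoulli w1).real (openConn s b) = (prodBernoulli w0).real (BRb ∪ Fb) := by
    rw [lift]; exact rp_congr hG1 fun ω hω => by rw [Set.mem_preimage, lB ω hω, Set.mem_union]
  have mC1 : (prodBernoulli w1).real (openConn s c) = (prodBernoulli w0).real (BRc ∪ Fc) := by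
    rw [lift]; exact rp_congr hG1 fun ω hω => by rw [Set.mem_preimage, lC ω hω, Set.mem_union]
  have mAB1 : (prodBernoulli w1).real (openConn s a ∩ openConn s b)
      = (prodBernoulli w0).real (AL ∪ Fa) * (prodBernoulli w0).real (BRb ∪ Fb) := by
    rw [lift, ← indep (hunion dAL dFa) (hunion dBRb dFb)]
    exact rp_congr hG1 fun ω hω => by
      rw [Set.mem_preimage, Set.mem_inter_iff, lA ω hω, lB ω hω, Set.mem_inter_iff, Set.mem_union, Set.mem_union]
  have mAC1 : (prodBernoulli w1).real (openConn s a ∩ openConn s c)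
      = (prodBernoulli w0).real (AL ∪ Fa) * (prodBernoulli w0).real (BRc ∪ Fc) := by
    rw [lift, ← indep (hunion dAL dFa) (hunion dBRc dFc)]
    exact rp_congr hG1 fun ω hω => by
      rw [Set.mem_preimage, Set.mem_inter_iff, lA ω hω, lC ω hω, Set.mem_inter_iff, Set.mem_union, Set.mem_union]
  have mBC1 : (prodBernoulli w1).real (openConn s b ∩ openConn s c) = (prodBernoulli w0).real ((BRb ∪ Fb) ∩ (BRc ∪ Fc)) := by
    rw [lift]
    exact rp_congr hG1 fun ω hω => by
      rw [Set.mem_preimage, Set.mem_inter_iff, lB ω hω, lC ω hω, Set.mem_inter_iff, Set.mem_union, Set.mem_union]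
  have mABC1 : (prodBernoulli w1).real (openConn s a ∩ openConn s b ∩ openConn s c)
      = (prodBernoulli w0).real (AL ∪ Fa) * (prodBernoulli w0).real ((BRb ∪ Fb) ∩ (BRc ∪ Fc)) := by
    rw [lift, ← indep (hunion dAL dFa) ((hunion dBRb dFb).inter (hunion dBRc dFc))]
    exact rp_congr hG1 fun ω hω => by
      simp only [Set.mem_preimage, Set.mem_inter_iff, lA ω hω, lB ω hω, lC ω hω, Set.mem_union]
      tauto
  -- sign facts
  have h0 : (0 : ℝ) ≤ p₀ := p₀.2.1
  have h1 : (p₁ : ℝ) ≤ 1 := p₁.2.2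
  have h01' : (p₀ : ℝ) ≤ p := h01
  have h12' : (p : ℝ) ≤ p₁ := h12
  -- (8) assemble: every moment under `w[e↦q]`, `q ∈ {p₀, p, p₁}`, is the `q`-mixture of the block polynomials
  rw [sahiE3_def, sahiE3_def, sahiE3_def]
  rw [ob p₀ (openConn s a ∩ openConn s b ∩ openConn s c), ob p₀ (openConn s a ∩ openConn s b), ob p₀ (openConn s a ∩ openConn s c),
    ob p₀ (openConn s b ∩ openConn s c), ob p₀ (openConn s a), ob p₀ (openConn s b), ob p₀ (openConn s c),
    ob p (openConn s a ∩ openConn s b ∩ openConn s c), ob p (openConn s a ∩ openConn s b), ob p (openConn s a ∩ openConn s c),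
    ob p (openConn s b ∩ openConn s c), ob p (openConn s a), ob p (openConn s b), ob p (openConn s c),
    ob p₁ (openConn s a ∩ openConn s b ∩ openConn s c), ob p₁ (openConn s a ∩ openConn s b), ob p₁ (openConn s a ∩ openConn s c),
    ob p₁ (openConn s b ∩ openConn s c), ob p₁ (openConn s a), ob p₁ (openConn s b), ob p₁ (openConn s c),
    mA0, mB0, mC0, mAB0, mAC0, mBC0, mABC0, mA1, mB1, mC1, mAB1, mAC1, mBC1, mABC1,
    zA, zB, zC, zBC, kA, kB, kC, kBC, hSLc, hSRc]
  have key := rootPairCubic_concave_real p₀ p p₁ ((prodBernoulli w0).real AL) ((prodBernoulli w0).real (Fa \ SL))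
    ((prodBernoulli w0).real (AL \ SL)) ((prodBernoulli w0).real (Set.univ \ SL))
    ((prodBernoulli w0).real BRb) ((prodBernoulli w0).real BRc) ((prodBernoulli w0).real (BRb ∩ BRc))
    ((prodBernoulli w0).real (Fb \ SR)) ((prodBernoulli w0).real (Fc \ SR)) ((prodBernoulli w0).real ((Fb ∩ Fc) \ SR))
    ((prodBernoulli w0).real ((Fb \ SR) ∩ BRc)) ((prodBernoulli w0).real ((Fc \ SR) ∩ BRb))
    ((prodBernoulli w0).real (BRb \ SR)) ((prodBernoulli w0).real (BRc \ SR)) ((prodBernoulli w0).real ((BRb ∩ BRc) \ SR))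
    ((prodBernoulli w0).real (Set.univ \ SR))
    h0 h01' h12' h1 measureReal_nonneg measureReal_nonneg measureReal_nonneg measureReal_nonneg measureReal_nonneg hPsi hBr
  linarith [key]

end IncStar

end Summit.CriticalPhenomena.PercolationContinuityZ3.Theorems
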